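import Summits.BirchSwinnertonDyer.BirchSwinnertonDyer.Theorems.KolyvaginRoadThreeMethod2KolyvaginPerfCocycles
import Summits.BirchSwinnertonDyer.Rank1Residual.X11b.KolyvaginRingClassTotalRamification
import Literature.NumberTheory.EllipticCurves.HeegnerPointsKolyvaginProp82Proofs
import HarnessLib

/-!
# KOLY method line, crux stmt-BirchSwinnertonDyer-19574 `ZhangSharpFrameAtThreeHL`, stub S2-ENGINE: LOCAL TOOLS FOR (Perf) AT A
# KOLYVAGIN PRIME — `μ₃` fixed, transverse classes rank one, `G_𝔓 = I_𝔓 · (G_𝔓 ∩ Stab K[ℓ])`, opposite eigenvectors pair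
# (cell `bsd-stepL`, seat `bsd-stepL-zhang3-p1` g9; `--supports 19574`, helper)

Second tools file for the binder (Perf) `hperf` of `Method2.triangulation_of_kolyvaginLocal` (p508963):

* `smul_eq_self_of_pow_three_eq_one_of_mem_torsionFixing` — `Γ_{K(E[3])}` fixes `μ₃` when a right-non-degenerate
  `Γ_K`-equivariant `μ₃`-valued pairing on `E[3]` exists (its values are fixed and exhaust `μ₃`);
* `exists_forall_apply_eq_nsmul_of_mem_transverseLocalKer` — at a Kolyvagin prime of W. Zhang **a transverse class is
  rank one on `Γ_{K_λ}`**: its cocycle is `s ↦ i(s) • Q₀` along the cyclic `Gal(K[ℓ]/K[1])` (`λ` splits completely in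
  `K[1]`; transversality kills the kernel);
* `exists_inertia_inv_mul_mem_ringClassStabilizer` — `G_𝔓 = I_𝔓 · (G_𝔓 ∩ Stab K[ℓ])` (total ramification of the primes
  above `λ` in `K[ℓ]/K[1]`, tree `RingClassTower.exists_mem_inertia_smul_eq_of_mem_ringClassGalOver`);
* `weil_ne_one_of_eigen` — `e(P, Q) ≠ 1` for non-zero eigenvectors `P ∈ E[3]^{ν}`, `Q ∈ E[3]^{-ν}` of an additive map
  (the annihilator of `P` is the line `ℤP`, Gross Prop. 8.1 (2); `3` odd).

References: W. Zhang, Camb. J. Math. 2 (2014), §8.1, Lemma 8.4; B. H. Gross (1991), Prop. 8.1–8.2, §3; D. Cox, *Primes of the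
form x² + ny²*, §9.
-/

noncomputable section

open scoped Classical Pointwise

namespace Summit.BirchSwinnertonDyer.Rank1Residual.X11b.Three.Koly.Method2.KolyLocal

open CategoryTheory WeierstrassCurve Field Function NumberField IsDedekindDomain
open Literature.NumberTheory.EllipticCurves Literature.NumberTheory.EllipticCurves.ModularForms
  Literature.NumberTheory.GaloisRepresentations Module
open Literature.NumberTheory.GaloisRepresentations.DiscreteGaloisModule (mu MuCarrier)
open Literature.NumberTheory.GaloisCohomology
open Summit.BirchSwinnertonDyer.Rank1Residual.X11b.Three.Koly.Method2
open Summit.BirchSwinnertonDyer.Rank1Residual.GaloisImage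
open scoped ContRepresentation

attribute [local instance] absoluteGaloisGroup_compactSpace
attribute [local instance] finite_geomTorsion_of_neZero

section Kolyvagin

variable (W : WeierstrassCurve ℚ) (K : Type) [Field K] [NumberField K] [W.IsElliptic] [W.IsGloballyMinimal]

omit [W.IsGloballyMinimal] in
/-- **`Γ_{K(E[3])}` fixes `μ₃`**, granted a bi-additive `Γ_K`-equivariant `μ₃`-valued pairing `e` on `E[3]`,
non-degenerate on the right: the values `e(P, Q)` are fixed by `Γ_{K(E[3])}` and exhaust `μ₃` (some `e(P, Q) ≠ 1` is a
primitive cube root of unity). [cite: SilvermanAEC2009, III.8.1] -/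
theorem smul_eq_self_of_pow_three_eq_one_of_mem_torsionFixing
    (e : geomTorsion (W.baseChange K) ((3 ^ 1 : ℕ) : ℤ) → geomTorsion (W.baseChange K) ((3 ^ 1 : ℕ) : ℤ) →
      AlgebraicClosure K)
    (hμ : ∀ P Q, e P Q ^ (3 ^ 1) = 1) (hnondeg : ∀ Q, (∀ P, e P Q = 1) → Q = 0)
    (hgal : ∀ (σ : absoluteGaloisGroup K) (P Q : geomTorsion (W.baseChange K) ((3 ^ 1 : ℕ) : ℤ)),
      σ • e P Q = e (σ • P) (σ • Q))
    {d : absoluteGaloisGroup K} (hd : d ∈ torsionFixing (W.baseChange K) ((3 ^ 1 : ℕ) : ℤ))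
    {ζ : AlgebraicClosure K} (hζ : ζ ^ 3 = 1) : d • ζ = ζ := by
  -- a non-zero `Q` and a `P` with `e P Q ≠ 1`
  have hcard : Nat.card (geomTorsion (W.baseChange K) ((3 ^ 1 : ℕ) : ℤ)) = 3 ^ 2 :=
    card_torsionPoints_eq_sq_holds (W.baseChange K) (AlgebraicClosure K) (n := 3) (by norm_num)
  haveI : Finite (geomTorsion (W.baseChange K) ((3 ^ 1 : ℕ) : ℤ)) :=
    Nat.finite_of_card_ne_zero (by rw [hcard]; norm_num)
  obtain ⟨Q, hQ⟩ : ∃ Q : geomTorsion (W.baseChange K) ((3 ^ 1 : ℕ) : ℤ), Q ≠ 0 := by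
    by_contra h
    push Not at h
    have : Nat.card (geomTorsion (W.baseChange K) ((3 ^ 1 : ℕ) : ℤ)) = 1 :=
      Nat.card_eq_one_iff_exists.mpr ⟨0, fun R ↦ h R⟩
    rw [hcard] at this
    norm_num at this
  obtain ⟨P, hP⟩ : ∃ P, e P Q ≠ 1 := by
    by_contra h
    push Not at h
    exact hQ (hnondeg Q h)
  -- `e P Q` is a primitive cube root of unity, fixed by `d`
  have hprim : IsPrimitiveRoot (e P Q) 3 := by
    refine IsPrimitiveRoot.mk_of_lt (e P Q) (by norm_num) (hμ P Q) fun l hl0 hl3 ↦ ?_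
    interval_cases l
    · rwa [pow_one]
    · intro h2
      apply hP
      have h3 := hμ P Q
      rw [show (3 ^ 1 : ℕ) = 2 + 1 by norm_num, pow_succ, h2, one_mul] at h3
      exact h3
  have hfix : d • e P Q = e P Q := by
    rw [hgal, smul_eq_of_mem_torsionFixing (W.baseChange K) _ hd, smul_eq_of_mem_torsionFixing (W.baseChange K) _ hd]
  obtain ⟨k, -, rfl⟩ := hprim.eq_pow_of_pow_eq_one hζ
  rw [smul_pow', hfix]

/-- **A transverse class is rank one on `Γ_{K_λ}`** at a Kolyvagin prime of W. Zhang: for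
`y ∈ Method2.transverseLocalKer W K ι ℓ v` with cocycle `φ`, there is `σ₀ ∈ Γ_{K_λ}` such that
`φ (res s) ∈ ℕ · φ (res σ₀)` for every `s ∈ Γ_{K_λ}` — the restriction of `Γ_{K_λ}` to `K[ℓ]` lands in the CYCLIC group
`Gal(K[ℓ]/K[1])` (`λ` splits completely in `K[1]`), with a generator `χ σ₀`, and `φ ∘ res` is additive (`G_𝔓` fixes
`E[3]`) and kills the kernel of `χ` (transversality). [cite: WZhang2014, §8.1 (H¹_tr)] [cite: GrossLMS1991, §3–§4] -/
theorem exists_forall_apply_eq_nsmul_of_mem_transverseLocalKer (hK : IsImaginaryQuadratic K) (ι : K →+* ℂ) {ℓ : ℕ}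
    (hℓ : Zhang2014.IsKolyvaginPrime (W.conductorNorm ℤ) W K 3 ℓ) (v : HeightOneSpectrum (𝓞 K))
    (hv : (ℓ : 𝓞 K) ∈ v.asIdeal) {𝔐 : Ideal (HeightOneSpectrum.localAbsIntegers v)} (h𝔐 : 𝔐 ∈ v.localPrimesAbove)
    {y : V3 W K} (hy : y ∈ transverseLocalKer W K ι ℓ v)
    (φ : contOneCocycles (discreteTopRep (absoluteGaloisGroup K) (geomTorsion (W.baseChange K) ((3 ^ 1 : ℕ) : ℤ))))
    (hφ : oneCocycleClass _ φ = y) :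
    ∃ σ₀ : absoluteGaloisGroup (v.adicCompletion K), ∀ s : absoluteGaloisGroup (v.adicCompletion K), ∃ i : ℕ,
      φ.1 (absGaloisRestrict K (v.adicCompletion K) s) = i • φ.1 (absGaloisRestrict K (v.adicCompletion K) σ₀) := by
  haveI : NeZero (3 ^ 1 : ℕ) := ⟨by norm_num⟩
  have hℓp : ℓ.Prime := hℓ.1
  have hℓ0 : ℓ ≠ 0 := hℓp.ne_zero
  have hℓP : (Ideal.span {(ℓ : 𝓞 K)}).IsPrime := hℓ.2.2.2.2.1
  haveI := (finiteDimensional_and_isGalois_ringClassField hK ι hℓ0).1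
  haveI := (finiteDimensional_and_isGalois_ringClassField hK ι hℓ0).2
  haveI := (finiteDimensional_and_isGalois_ringClassField hK ι one_ne_zero).1
  haveI : FiniteDimensional ℚ (ringClassField K ι ℓ) := Module.Finite.trans K (ringClassField K ι ℓ)
  set Kv := v.adicCompletion K with hKv
  set ι₀ := closureEmb (K := K) Kv with hι₀
  set 𝔓 := v.primeBelow ι₀ 𝔐 with h𝔓def
  have h𝔓 : 𝔓 ∈ v.primesAbove := HeightOneSpectrum.primeBelow_mem_primesAbove h𝔐
  have hres : ∀ s : absoluteGaloisGroup Kv,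
      absGaloisRestrict K Kv s ∈ 𝔓.decompositionSubgroup (absoluteGaloisGroup K) := fun s ↦ by
    rw [← resGal_eq_absGaloisRestrict, resGal_eq]
    exact resGalOfEmb_mem_decompositionSubgroup ι₀ h𝔐 s
  have hfix : ∀ (s : absoluteGaloisGroup Kv) (Q : geomTorsion (W.baseChange K) ((3 ^ 1 : ℕ) : ℤ)),
      absGaloisRestrict K Kv s • Q = Q := fun s Q ↦
    smul_torsion_eq_self_of_mem_decompositionSubgroup W K hK hℓ v hv h𝔐 (hres s) Q
  have htf : ∀ s : absoluteGaloisGroup Kv,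
      absGaloisRestrict K Kv s ∈ torsionFixing (W.baseChange K) ((3 ^ 1 : ℕ) : ℤ) := fun s ↦
    decompositionSubgroup_le_torsionFixing W K hK hℓ v hv h𝔐 (hres s)
  -- the restriction `χ : Γ_{K_v} → Gal(K[ℓ]/K)` along a `K`-embedding `e₀ : K[ℓ] → K̄`
  let e₀ : ringClassField K ι ℓ →ₐ[K] AlgebraicClosure K := IsAlgClosed.lift
  obtain ⟨π, hπ⟩ := KolyvaginH44.exists_absGaloisRestrict hK ι ℓ e₀
  let χ : absoluteGaloisGroup Kv →* ringClassGal ι ℓ := π.comp (absGaloisRestrict K Kv).toMonoidHom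
  have hχ : ∀ s, χ s = π (absGaloisRestrict K Kv s) := fun _ ↦ rfl
  have hker : ∀ s, χ s = 1 → absGaloisRestrict K Kv s ∈ ringClassStabilizer K ι ℓ ℓ := by
    intro s hs
    refine mem_ringClassStabilizer_of_forall_smul_eq K hK ι hℓ0 e₀ fun z ↦ ?_
    rw [hπ, ← hχ, hs, OneMemClass.coe_one, AlgEquiv.one_apply]
  -- the image of `χ` lies in the cyclic `Gal(K[ℓ]/K[1])`
  have h1ℓ : ringClassField K ι 1 ≤ ringClassField K ι ℓ := ringClassField_mono hK ι (one_dvd ℓ) hℓ0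
  have himg : ∀ s, ((χ s : ringClassGal ι ℓ) : ringClassField K ι ℓ ≃ₐ[ℚ] ringClassField K ι ℓ) ∈
      ringClassGalOver ι ℓ 1 := by
    intro s
    rw [ringClassGalOver, mem_fixingSubgroup_iff]
    intro z hz
    rw [AlgEquiv.smul_def]
    obtain ⟨z₁, hz₁⟩ : ∃ z₁ : ringClassField K ι 1, RingClassField.inclusion ι h1ℓ z₁ = z :=
      ⟨⟨(z : ℂ), hz⟩, Subtype.ext (RingClassField.coe_inclusion ι h1ℓ _)⟩
    have key : e₀ (((χ s : ringClassGal ι ℓ) : ringClassField K ι ℓ ≃ₐ[ℚ] ringClassField K ι ℓ) z) = e₀ z := by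
      rw [hχ, ← hπ, ← hz₁]
      exact smul_ringClassFieldOne_eq_self_of_mem_decompositionSubgroup W K hK ι hℓ v hv h𝔓
        (e₀.comp (RingClassField.inclusion ι h1ℓ)) (hres s) z₁
    exact e₀.injective key
  have hcycG : IsCyclic (ringClassGalOver ι ℓ 1) := by
    have h := RingClassGalOverCyclic.isCyclic_ringClassGalOver hK ι (ℓ := ℓ) (m' := 1) one_ne_zero hℓp
      (fun h ↦ hℓp.one_lt.ne' (Nat.dvd_one.mp h)) hℓP
    rwa [Nat.mul_one] at h
  have hcyc : ∃ σ : absoluteGaloisGroup Kv, ∀ s, ∃ i : ℕ, χ s = χ σ ^ i := by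
    let ψ : absoluteGaloisGroup Kv →* ringClassGalOver ι ℓ 1 :=
      ((ringClassGal ι ℓ).subtype.comp χ).codRestrict (ringClassGalOver ι ℓ 1) (fun s ↦ himg s)
    have hψ : ∀ s, ((ψ s : ringClassGalOver ι ℓ 1) : ringClassField K ι ℓ ≃ₐ[ℚ] ringClassField K ι ℓ) =
        (χ s : ringClassField K ι ℓ ≃ₐ[ℚ] ringClassField K ι ℓ) := fun _ ↦ rfl
    haveI : IsCyclic ψ.range := isCyclic_of_injective ψ.range.subtype ψ.range.subtype_injective
    obtain ⟨g₀, hg₀⟩ := IsCyclic.exists_monoid_generator (α := ψ.range)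
    obtain ⟨σ, hσ⟩ := MonoidHom.mem_range.mp g₀.2
    refine ⟨σ, fun s ↦ ?_⟩
    obtain ⟨i, hi⟩ := (Submonoid.mem_powers_iff _ _).mp (hg₀ ⟨ψ s, ⟨s, rfl⟩⟩)
    refine ⟨i, Subtype.ext ?_⟩
    have h1 : ((g₀ ^ i : ψ.range) : ringClassGalOver ι ℓ 1) = ψ s := congrArg Subtype.val hi
    rw [SubmonoidClass.coe_pow, ← hσ] at h1
    have h2 := congrArg (fun t : ringClassGalOver ι ℓ 1 ↦ (t : ringClassField K ι ℓ ≃ₐ[ℚ] ringClassField K ι ℓ))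
      h1
    simp only [SubmonoidClass.coe_pow, hψ] at h2
    rw [SubmonoidClass.coe_pow]
    exact h2.symm
  obtain ⟨σ₀, hσ₀⟩ := hcyc
  -- `φ ∘ res` is additive and kills `ker χ`
  have hadd : ∀ s t : absoluteGaloisGroup Kv, φ.1 (absGaloisRestrict K Kv (s * t)) =
      φ.1 (absGaloisRestrict K Kv s) + φ.1 (absGaloisRestrict K Kv t) := fun s t ↦ by
    rw [map_mul, φ.2]
    change _ + absGaloisRestrict K Kv s • φ.1 (absGaloisRestrict K Kv t) = _
    rw [hfix]
  have hone : φ.1 (absGaloisRestrict K Kv 1) = 0 := by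
    have h := hadd 1 1
    rw [mul_one] at h
    exact left_eq_add.mp h
  have hpow : ∀ (s : absoluteGaloisGroup Kv) (m : ℕ), φ.1 (absGaloisRestrict K Kv (s ^ m)) =
      m • φ.1 (absGaloisRestrict K Kv s) := fun s m ↦ by
    induction m with
    | zero => rw [pow_zero, hone, zero_smul]
    | succ m ih => rw [pow_succ s m, hadd, ih, succ_nsmul]
  have hvan : ∀ s, χ s = 1 → φ.1 (absGaloisRestrict K Kv s) = 0 := fun s hs ↦ by
    have h := (mem_transverseLocalKer_iff.mp hy) 𝔓 h𝔓 _ (hres s) (hker s hs) (htf s)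
    rwa [← hφ, h1Eval_oneCocycleClass _ _ φ (htf s)] at h
  refine ⟨σ₀, fun s ↦ ?_⟩
  obtain ⟨i, hi⟩ := hσ₀ s
  refine ⟨i, ?_⟩
  have hs : s = (s * (σ₀ ^ i)⁻¹) * σ₀ ^ i := by rw [inv_mul_cancel_right]
  have hk : χ (s * (σ₀ ^ i)⁻¹) = 1 := by rw [map_mul, map_inv, map_pow, hi, mul_inv_cancel]
  rw [hs, hadd, hvan _ hk, zero_add, hpow]

omit [W.IsElliptic] in
/-- **`G_𝔓 = I_𝔓 · (G_𝔓 ∩ Stab K[ℓ])` at a Kolyvagin prime** (`λ = (ℓ)` splits completely in `K[1]` and the primes above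
it are totally ramified in `K[ℓ]/K[1]`): every `d ∈ G_𝔓` is `i · d'` with `i ∈ I_𝔓` and `d'` in the stabiliser of `K[ℓ]`
(tree `RingClassTower.exists_mem_inertia_smul_eq_of_mem_ringClassGalOver`, `smul_ringClassFieldOne_eq_self_of_mem_decompositionSubgroup`).
[cite: GrossLMS1991, §3 (p. 218 l. 1)] [cite: Cox2013, §9.A] -/
theorem exists_inertia_inv_mul_mem_ringClassStabilizer (hK : IsImaginaryQuadratic K) (ι : K →+* ℂ) {ℓ : ℕ}
    (hℓ : Zhang2014.IsKolyvaginPrime (W.conductorNorm ℤ) W K 3 ℓ) (v : HeightOneSpectrum (𝓞 K))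
    (hv : (ℓ : 𝓞 K) ∈ v.asIdeal) (hv₀ : ∀ v' : HeightOneSpectrum (𝓞 K), ((ℓ : ℕ) : 𝓞 K) ∈ v'.asIdeal ↔ v' = v)
    {𝔓 : Ideal (absIntegers (𝓞 K) K)} (h𝔓 : 𝔓 ∈ v.primesAbove) {d : absoluteGaloisGroup K}
    (hd : d ∈ 𝔓.decompositionSubgroup (absoluteGaloisGroup K)) :
    ∃ i ∈ 𝔓.inertia (absoluteGaloisGroup K), i⁻¹ * d ∈ ringClassStabilizer K ι ℓ ℓ := by
  have hℓp : ℓ.Prime := hℓ.1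
  have hℓ0 : ℓ ≠ 0 := hℓp.ne_zero
  haveI := (finiteDimensional_and_isGalois_ringClassField hK ι hℓ0).1
  haveI := (finiteDimensional_and_isGalois_ringClassField hK ι hℓ0).2
  haveI := (finiteDimensional_and_isGalois_ringClassField hK ι one_ne_zero).1
  let e₀ : ringClassField K ι ℓ →ₐ[K] AlgebraicClosure K := IsAlgClosed.lift
  obtain ⟨π, hπ⟩ := KolyvaginH44.exists_absGaloisRestrict hK ι ℓ e₀
  have h1ℓ : ringClassField K ι 1 ≤ ringClassField K ι ℓ := ringClassField_mono hK ι (one_dvd ℓ) hℓ0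
  have himg : ((π d : ringClassGal ι ℓ) : ringClassField K ι ℓ ≃ₐ[ℚ] ringClassField K ι ℓ) ∈ ringClassGalOver ι ℓ (ℓ / ℓ) := by
    rw [Nat.div_self hℓp.pos, ringClassGalOver, mem_fixingSubgroup_iff]
    intro z hz
    rw [AlgEquiv.smul_def]
    obtain ⟨z₁, hz₁⟩ : ∃ z₁ : ringClassField K ι 1, RingClassField.inclusion ι h1ℓ z₁ = z :=
      ⟨⟨(z : ℂ), hz⟩, Subtype.ext (RingClassField.coe_inclusion ι h1ℓ _)⟩
    have key : e₀ (((π d : ringClassGal ι ℓ) : ringClassField K ι ℓ ≃ₐ[ℚ] ringClassField K ι ℓ) z) = e₀ z := by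
      rw [← hπ, ← hz₁]
      exact smul_ringClassFieldOne_eq_self_of_mem_decompositionSubgroup W K hK ι hℓ v hv h𝔓
        (e₀.comp (RingClassField.inclusion ι h1ℓ)) hd z₁
    exact e₀.injective key
  obtain ⟨τ, hτI, hτ⟩ := RingClassTower.exists_mem_inertia_smul_eq_of_mem_ringClassGalOver hK ι hℓ0 hℓp (dvd_refl ℓ)
    (fun h ↦ hℓp.one_lt.ne' (Nat.dvd_one.mp (by rwa [Nat.div_self hℓp.pos] at h))) hv₀ h𝔓 e₀ himg
  refine ⟨τ, hτI, mem_ringClassStabilizer_of_forall_smul_eq K hK ι hℓ0 e₀ fun z ↦ ?_⟩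
  rw [mul_smul, hπ, ← hτ z, inv_smul_smul]


omit [W.IsGloballyMinimal] in
/-- **Opposite eigenvectors pair non-trivially**: for a bi-additive alternating right-non-degenerate `μ₃`-valued pairing
`e` on `E[3] ≅ (ℤ/3)²`, an additive `ι` and `ν = ±1`, if `P ≠ 0`, `ι P = ν P`, `Q ≠ 0`, `ι Q = -ν Q`, then `e(P, Q) ≠ 1`:
otherwise `Q` lies in the annihilator `ℤ P` of `P` (`KolyvaginReciprocity.mem_zmultiples_of_pairing_eq_zero`, a line)
and an eigenvector of both signs vanishes, `3` being odd (`eq_zero_of_eigen_of_mem_zmultiples`).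
[cite: GrossLMS1991, Prop. 8.1 (2) (proof)] -/
theorem weil_ne_one_of_eigen
    (e : geomTorsion (W.baseChange K) ((3 ^ 1 : ℕ) : ℤ) → geomTorsion (W.baseChange K) ((3 ^ 1 : ℕ) : ℤ) →
      AlgebraicClosure K)
    (hμ : ∀ P Q, e P Q ^ (3 ^ 1) = 1) (hadd₁ : ∀ P₁ P₂ Q, e (P₁ + P₂) Q = e P₁ Q * e P₂ Q)
    (hadd₂ : ∀ P Q₁ Q₂, e P (Q₁ + Q₂) = e P Q₁ * e P Q₂) (halt : ∀ Q, e Q Q = 1)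
    (hnondeg : ∀ Q, (∀ P, e P Q = 1) → Q = 0)
    (ιT : geomTorsion (W.baseChange K) ((3 ^ 1 : ℕ) : ℤ) →+ geomTorsion (W.baseChange K) ((3 ^ 1 : ℕ) : ℤ))
    {ν : ℤ} (hν : ν = 1 ∨ ν = -1) {P Q : geomTorsion (W.baseChange K) ((3 ^ 1 : ℕ) : ℤ)}
    (hP : ιT P = ν • P) (hP0 : P ≠ 0) (hQ : ιT Q = -(ν • Q)) (hQ0 : Q ≠ 0) : e P Q ≠ 1 := by
  intro hPQ
  haveI : Fact (Nat.Prime 3) := ⟨Nat.prime_three⟩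
  have hne : ∀ a b, e a b ≠ 0 := fun a b h0 ↦ by
    have h := hμ a b
    rw [h0, zero_pow (by norm_num)] at h
    exact zero_ne_one h
  -- the additive flipped pairing `E a b = e(b, a)` with values in `Additive K̄ˣ`
  have hmk₁ : ∀ a a' b, Units.mk0 (e (a + a') b) (hne _ _) = Units.mk0 (e a b) (hne _ _) * Units.mk0 (e a' b) (hne _ _) :=
    fun a a' b ↦ Units.ext (by rw [Units.val_mk0, Units.val_mul, Units.val_mk0, Units.val_mk0, hadd₁])
  have hmk₂ : ∀ a b b', Units.mk0 (e a (b + b')) (hne _ _) = Units.mk0 (e a b) (hne _ _) * Units.mk0 (e a b') (hne _ _) :=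
    fun a b b' ↦ Units.ext (by rw [Units.val_mk0, Units.val_mul, Units.val_mk0, Units.val_mk0, hadd₂])
  let E : geomTorsion (W.baseChange K) ((3 ^ 1 : ℕ) : ℤ) →+ geomTorsion (W.baseChange K) ((3 ^ 1 : ℕ) : ℤ) →+
      Additive (AlgebraicClosure K)ˣ :=
    AddMonoidHom.mk' (fun a ↦ AddMonoidHom.mk' (fun b ↦ Additive.ofMul (Units.mk0 (e b a) (hne b a)))
      (fun b b' ↦ by rw [← ofMul_mul, ← hmk₁]))
      (fun a a' ↦ by ext b; simp only [AddMonoidHom.mk'_apply, AddMonoidHom.add_apply]; rw [← ofMul_mul, ← hmk₂])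
  have hE0 : ∀ a b, E a b = 0 ↔ e b a = 1 := fun a b ↦ by
    change Additive.ofMul (Units.mk0 (e b a) (hne b a)) = 0 ↔ _
    rw [ofMul_eq_zero, Units.ext_iff, Units.val_mk0, Units.val_one]
  -- `E[3] ≅ (ℤ/3)²`
  have hcard : Nat.card (geomTorsion (W.baseChange K) ((3 ^ 1 : ℕ) : ℤ)) = 3 ^ 2 :=
    card_torsionPoints_eq_sq_holds (W.baseChange K) (AlgebraicClosure K) (n := 3) (by norm_num)
  have hpT : ∀ R : geomTorsion (W.baseChange K) ((3 ^ 1 : ℕ) : ℤ), 3 • R = 0 := fun R ↦ by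
    have := (mem_geomTorsion_iff (W.baseChange K) ((3 ^ 1 : ℕ) : ℤ) _).mp R.2
    apply Subtype.ext
    rw [AddSubgroupClass.coe_nsmul, ← natCast_zsmul]
    exact this
  have halt' : ∀ a, E a a = 0 := fun a ↦ (hE0 a a).mpr (halt a)
  have hnd' : ∀ a, (∀ b, E a b = 0) → a = 0 := fun a h ↦ hnondeg a fun b ↦ (hE0 a b).mp (h b)
  have hmem : Q ∈ AddSubgroup.zmultiples P :=
    KolyvaginReciprocity.mem_zmultiples_of_pairing_eq_zero hcard hpT E halt' hnd' hP0 ((hE0 Q P).mpr hPQ)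
  have hν' : -ν = 1 ∨ -ν = -1 := by rcases hν with rfl | rfl <;> simp
  have hP' : ιT P = -((-ν) • P) := by rw [neg_smul, neg_neg]; exact hP
  have hQ' : ιT Q = (-ν) • Q := by rw [neg_smul]; exact hQ
  exact hQ0 (KolyvaginReciprocity.eq_zero_of_eigen_of_mem_zmultiples Nat.prime_three (by norm_num) hpT ιT hν' hP'
    hQ' hmem)

end Kolyvagin

end Summit.BirchSwinnertonDyer.Rank1Residual.X11b.Three.Koly.Method2.KolyLocal

end
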